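import Mathlib.Data.Fintype.BigOperators
import Mathlib.Data.Fintype.Pi
import Mathlib.Data.Fin.Tuple.Basic
import Mathlib.Algebra.BigOperators.Group.Finset.Basic
import Mathlib.Algebra.Order.BigOperators.Group.Finset
import Mathlib.Algebra.Group.Action.Defs
import Mathlib.Tactic.Ring
import Mathlib.Tactic.Linarith
import HarnessLib

/-!
# Points of a discrete box near its boundary (union bound)

Topic `Literature/Combinatorics/Enumerative`. Everything here is PROVED. For the discrete box
`[0, M)ⁿ` and a margin `K`, the number of points having SOME coordinate within `K` of the boundary
(`aᵢ < K` or `aᵢ ≥ M − K`) is at most `n · 2K · Mⁿ⁻¹` (`card_nearBoundary_le`), i.e. a uniformly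
random point of the box is within `K` of the boundary in some coordinate with probability at most
`2nK/M` — the union bound over the `n` coordinates of the one-coordinate count `≤ 2K · Mⁿ⁻¹`
(`card_filter_coord_le`).

This is the first error term of Regev's Claim 3.14 (*Quantum computation and lattice problems*,
SIAM J. Comput. 33 (2004), p. 15: "unless there exists an `i` for which `aᵢ < 2^{2n}` or
`aᵢ > M − 2^{2n}`, `ā'` is guaranteed to be in `A`. This happens with probability at most
`n 2^{2n+1}/M` because `ā` is a random element of `A`"), isolated as the elementary counting fact it
is; groundwork for the named fact `Literature.Algebra.EuclideanLattices.usvp_of_dihedralCoset`.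

## References

* O. Regev, *Quantum computation and lattice problems*, SIAM J. Comput. 33 (2004) 738–760, proof of
  Claim 3.14 (p. 15) [Regev2004].
-/

namespace Literature.Combinatorics.Enumerative

open Finset

/-- The one-coordinate margin of `[0, M)`: values `v` with `v < K` or `M ≤ v + K`. [folklore] -/
def margin (M K : ℕ) : Finset (Fin M) :=
  univ.filter fun v : Fin M => (v : ℕ) < K ∨ M ≤ (v : ℕ) + K

/-- Membership in the margin. [folklore] -/
@[simp] theorem mem_margin {M K : ℕ} {v : Fin M} : v ∈ margin M K ↔ (v : ℕ) < K ∨ M ≤ (v : ℕ) + K := by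
  simp [margin]

/-- The margin has at most `2K` elements (`≤ K` low values, `≤ K` high values). [folklore] -/
theorem card_margin_le (M K : ℕ) : (margin M K).card ≤ 2 * K := by
  classical
  set lowS : Finset (Fin M) := univ.filter fun v : Fin M => (v : ℕ) < K with hlowS
  set highS : Finset (Fin M) := univ.filter fun v : Fin M => M ≤ (v : ℕ) + K with hhighS
  have hsub : margin M K ⊆ lowS ∪ highS := by
    intro v hv
    rw [mem_margin] at hv
    rw [mem_union, hlowS, hhighS, mem_filter, mem_filter]
    rcases hv with h | h
    · exact Or.inl ⟨mem_univ v, h⟩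
    · exact Or.inr ⟨mem_univ v, h⟩
  have h1 : lowS.card ≤ K := by
    calc lowS.card ≤ (range K).card := by
          refine card_le_card_of_injOn (fun v : Fin M => (v : ℕ)) (fun v hv => ?_) ?_
          · have hv' : (v : ℕ) < K := by
              rw [hlowS] at hv; simpa using hv
            simpa using hv'
          · intro a _ b _ h
            exact Fin.ext h
      _ = K := card_range K
  have h2 : highS.card ≤ K := by
    calc highS.card ≤ (range K).card := by
          refine card_le_card_of_injOn (fun v : Fin M => M - 1 - (v : ℕ)) (fun v hv => ?_) ?_
          · have hv' : M ≤ (v : ℕ) + K := by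
              rw [hhighS] at hv; simpa using hv
            have := v.2
            simp only [coe_range, Set.mem_Iio]
            omega
          · intro a ha b hb h
            have ha' : M ≤ (a : ℕ) + K := by
              rw [hhighS] at ha; simpa using ha
            have := a.2
            have := b.2
            exact Fin.ext (by simp only at h; omega)
      _ = K := card_range K
  calc (margin M K).card ≤ (lowS ∪ highS).card := card_le_card hsub
    _ ≤ lowS.card + highS.card := card_union_le _ _
    _ ≤ 2 * K := by omega

/-- **One coordinate.** In the box `[0, M)^{m+1}`, the points whose `i`-th coordinate lies in the
margin number at most `2K · Mᵐ`. [folklore] -/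
theorem card_filter_coord_le (m M K : ℕ) (i : Fin (m + 1)) :
    ((univ : Finset (Fin (m + 1) → Fin M)).filter fun a => a i ∈ margin M K).card ≤
      2 * K * M ^ m := by
  classical
  -- the filtered box is the image of `margin × box` under `insertNth i`
  have heq : ((univ : Finset (Fin (m + 1) → Fin M)).filter fun a => a i ∈ margin M K) =
      (margin M K ×ˢ (univ : Finset (Fin m → Fin M))).map
        (Fin.insertNthEquiv (fun _ => Fin M) i).toEmbedding := by
    ext a
    simp only [mem_filter, mem_univ, true_and, mem_map, mem_product, Equiv.toEmbedding_apply,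
      and_true, Prod.exists]
    constructor
    · intro ha
      exact ⟨a i, Fin.removeNth i a, ha, Fin.insertNth_self_removeNth i a⟩
    · rintro ⟨v, b, hv, rfl⟩
      simpa using hv
  rw [heq, card_map, card_product, card_univ, Fintype.card_fun, Fintype.card_fin, Fintype.card_fin]
  exact Nat.mul_le_mul_right _ (card_margin_le M K)

/-- **Points near the boundary of a discrete box (union bound).** In the box `[0, M)ⁿ`, the points
having some coordinate `aᵢ < K` or `aᵢ ≥ M − K` number at most `n · 2K · Mⁿ⁻¹`; equivalently a
uniformly random point of the box is that close to the boundary with probability `≤ 2nK/M`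
(Regev 2004, proof of Claim 3.14, with `K = 2^{2n}`: "probability at most `n 2^{2n+1}/M`").
[cite: Regev2004, Claim 3.14 (proof, p. 15)] -/
theorem card_nearBoundary_le (n M K : ℕ) :
    ((univ : Finset (Fin n → Fin M)).filter
        fun a => ∃ i, ((a i : ℕ) < K ∨ M ≤ (a i : ℕ) + K)).card ≤ n * (2 * K) * M ^ (n - 1) := by
  classical
  cases n with
  | zero => simp
  | succ m =>
      have hsub : ((univ : Finset (Fin (m + 1) → Fin M)).filter
          fun a => ∃ i, ((a i : ℕ) < K ∨ M ≤ (a i : ℕ) + K)) ⊆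
          (univ : Finset (Fin (m + 1))).biUnion fun i =>
            (univ : Finset (Fin (m + 1) → Fin M)).filter fun a => a i ∈ margin M K := by
        intro a ha
        have ha' : ∃ i, ((a i : ℕ) < K ∨ M ≤ (a i : ℕ) + K) := by simpa using ha
        simpa using ha'
      calc ((univ : Finset (Fin (m + 1) → Fin M)).filter
              fun a => ∃ i, ((a i : ℕ) < K ∨ M ≤ (a i : ℕ) + K)).card
          ≤ ∑ i : Fin (m + 1), ((univ : Finset (Fin (m + 1) → Fin M)).filter
              fun a => a i ∈ margin M K).card :=
            (card_le_card hsub).trans card_biUnion_le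
        _ ≤ ∑ _i : Fin (m + 1), 2 * K * M ^ m := sum_le_sum fun i _ => card_filter_coord_le m M K i
        _ = (m + 1) * (2 * K) * M ^ (m + 1 - 1) := by
            rw [sum_const, card_univ, Fintype.card_fin, smul_eq_mul, Nat.add_sub_cancel]; ring

end Literature.Combinatorics.Enumerative
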